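/-
Copyright (c) 2026 the pub-hodgecm-mathlib formalisation cell (harness21).  Prover seat hodgecm-mathlib-F0P3-p02 (g27), 2026-09-03.  E1 row 57 «(J)-JUNCTION: THE SCHNEIDER–STUHLER
CHAIN SPACES ARE DIRECT SUMS OF COMPACT INDUCTIONS», FILE B (instantiation at ★ 5a; E1 keeper ∕ dealer F0P3a-p03 (g30) 03:21:28Z ∕ 03:26:31Z «= ×6»; census eaa3b19d).
-/
import Literature.NumberTheory.Automorphic.BlockPermutationCompactInduction    -- ★ row 57 FILE A (F0P3-p02): `exists_equiv_directSum_cIndRep`, `isSmooth_of_chart`, `finrank_intertwiningMap_eq_sum_of_blocks`; brings ★ 45 + ★ C-IND FROBENIUS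
import Literature.NumberTheory.Automorphic.SchneiderStuhlerTreeComplexGlobal     -- ★ 47d-5a (F0P3a-p04): `isInternal_zeroBlocks_univ ∕ isInternal_oneBlocks_univ ∕ rep_mem_zeroBlock ∕ rep_mem_oneBlock ∕ rep_zeroChains_single ∕ rep_oneChains_single ∕ apply_mem_fixedPoints_act`; brings ★ 41d I–II, ★ 41f-B1
import Literature.RepresentationTheory.Semisimple.Multiplicity                      -- ★ `Literature.RepresentationTheory.Semisimple.Representation.IntertwiningMap.congrLeft` (transport of `Hom_Γ(·, π)` along an equivalence)
import HarnessLib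

/-!
# The Schneider–Stuhler chain spaces are direct sums of compact inductions: `C_q(X;V) ≅ ⊕_{F ∈ Γ∖X_q} c-Ind_{P_F}^Γ V^{U_F}` (Schneider–Stuhler 1997, II.2–II.3, III.4)

Topic `NumberTheory/Automorphic`; namespace `Representation` (next to ★ 41d `SchneiderStuhlerTreeComplexFinite ∕ …Action`, ★ 5a `…Global`, ★ row 57 FILE A `BlockPermutationCompactInduction`).
THEOREMS ONLY (no definition, no instance, no notation, no named fact, no `sorry`).  Cell `pub/hodgecm-mathlib` (D-0151), crux H413 = `stmt-HodgeConjecture-24833`, lane `--supports`;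
E1 BRICK LEDGER row 57 FILE B — the (J)-JUNCTION between ★ 5a's GLOBAL chain modules `C₀(X) = ↥(⨆_x [x ↦ V^{U_x}])`, `C₁(X) = ↥(⨆_e [e ↦ V^{U_e}])` (`Γ`-representations `ρ₀`, `ρ₁`
hypothesis-style, `S = univ`) and the abstract `q`-chains `C_q := ⨁_{i, dᵢ = q} c-Ind_{Pᵢ}^Γ τᵢ` of ★ 45 `CompactInductionDirectSumFrobenius` ∕ the family of ★ 42 `smoothTrace_epFunction`.
HONEST LABEL: count-neutral generic base layer; (R-SS) banked PAYDOWN-UNR for K1 only; E1 = PRINT until the keeper's charter test; HC_CM is proved only modulo the printed citations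
(hLiu418 = `stmt-HodgeConjecture-24832`, h413 = `stmt-HodgeConjecture-24833`) until rung 0 closes.

THE MATHEMATICS [SchneiderStuhler1997, Ch. II §2 (the chain spaces of `γ_e(V)` «decompose as `⊕_F c-Ind_{P_F^†}^G V^{U_F^{(e)}}` over representatives of the `G`-orbits of facets»),
Ch. III §4; MeyerSolleveld2010 §2].  `Γ` acts on the tree `X` (vertices `ι`, `a : Γ →* Aut X`) preserving an orientation `σ`, with transported vertex groups `U_{g·x} = g U_x g⁻¹`; the
vertex blocks `[x ↦ V^{U_x}]` of `C₀(X)` are an internal direct sum PERMUTED by `Γ` (★ 5a §4), likewise the edge blocks of `C₁(X)`.  ORBIT DATA (hypothesis-style, the output of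
the datum's orbit geometry — E1 row 55): vertex representatives `xv : ι₀ → ι`, orbit index `idx₀`, transporters `tr₀` (`idx₀ (xv i) = i`, `idx₀ (g·x) = idx₀ x`, `tr₀ x · xv (idx₀ x) = x`),
stabilisers `P₀ i = Stab_Γ(xv i)` with the local representations `σ₀ i` of `P₀ i` on `V^{U_{xv i}}` (`= ρ` restricted: `P₀ i` normalises `U_{xv i}`); the edge twin `xe idx₁ tr₁ P₁ σ₁`
on `G.edgeSet` with `g·e = (a g).mapEdgeSet e` and `V^{U_e} = V^{U_{head e} ⊔ U_{tail e}}`.  THEN (FILE A `exists_equiv_directSum_cIndRep` with the charts `w ↦ [xv i ↦ w]`):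
  **`C₀(X) ≅ ⊕_{i ∈ ι₀} c-Ind_{P₀ i}^Γ σ₀ i`**, **`C₁(X) ≅ ⊕_{i ∈ ι₁} c-Ind_{P₁ i}^Γ σ₁ i`** as `Γ`-representations,
and, for finitely many orbits and an admissible-type target `π` (`k` a field): `dim Hom_Γ(C₀(X), π) = Σ_{i} dim Hom_{P₀ i}(σ₀ i, π|)`, `dim Hom_Γ(C₁(X), π) = Σ_{i} dim Hom_{P₁ i}(σ₁ i, π|)`,
hence ★ 45's `q`-chain count equals the count on `ρ_q` and the ℤ-valued END-TO-END LINE `Σ_{i ∈ ι₀ ⊕ ι₁} (−1)^{d i} dim Hom_{P i}(τ i, π|) = dim Hom_Γ(ρ₀, π) − dim Hom_Γ(ρ₁, π)`.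

* §1 `isOpen_of_forall_mem_iff_apply_eq` (vertex stabilisers open), `isOpen_of_forall_mem_iff_mapEdgeSet_eq` (edge stabilisers open: they contain the open two-point stabiliser),
  `isSmooth_of_coe_apply_eq` (the local representations on `V^{U_F}` are smooth when `ρ` is); the edge action `g·e = (a g).mapEdgeSet e` is an action by ★ BakerNorine
  `mapEdgeSet_mul ∕ mapEdgeSet_one` (`GraphAutomorphismsOneForms`), used inline.
* §2 VERTICES: `single_fixedPoints_mem_zeroChains_univ`, **`exists_equiv_directSum_cIndRep_zeroChains`**, `finrank_intertwiningMap_zeroChains_eq_sum`.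
* §3 EDGES: `single_fixedPoints_mem_oneChains_univ`, **`exists_equiv_directSum_cIndRep_oneChains`**, `finrank_intertwiningMap_oneChains_eq_sum`.
* §4 THE ★45-SHAPED JUNCTION: `finrank_intertwiningMap_directSum_cIndRep_filter_eq` (`q`-chains over `univ.filter (d · = q)`, `d = Sum.elim 0 1` on `ι₀ ⊕ ι₁`, `q = 0, 1`) and the
  end-to-end line `alternatingSum_finrank_intertwiningMap_eq_sub`.
Consumers: K2′∕K4′ (★ (J) `finrank_intertwiningMap_presentation` over ★ 5a `shortExact_univ`), row 59 census; the orbit data is discharged by E1 row 55 (U(3): two vertex orbits, one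
edge orbit at an unramified place).

## References
* [SchneiderStuhler1997] P. Schneider, U. Stuhler, *Representation theory and sheaves on the Bruhat–Tits building*, Publ. Math. IHÉS 85 (1997): Ch. II §2–§3 (chain spaces of `γ_e(V)` as
  sums of compact inductions over orbit representatives of facets; Thm. II.3.1), Ch. III §4 (Euler–Poincaré functions).
* [MeyerSolleveld2010] R. Meyer, M. Solleveld, *Resolutions for representations of reductive p-adic groups via their buildings*, J. reine angew. Math. 647 (2010): §2 (the complex
  `C_*(Σ; V)`, Thm. 2.4).
* [Brown1982] K. S. Brown, *Cohomology of Groups*, GTM 87 (1982): III §5 (5.3)–(5.4).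
-/

set_option autoImplicit false

open scoped BigOperators DirectSum
open Function SimpleGraph Literature.NumberTheory.Automorphic Literature.Combinatorics.SimpleGraph Literature.Combinatorics.SimpleGraph.OrientedIncidence
open Literature.Combinatorics.SimpleGraph.BakerNorine (coe_mapEdgeSet mapEdgeSet_mul mapEdgeSet_one)

namespace Representation

/-! ## §1 Stabilisers are open; the local representations are smooth -/

section Stabilizers

variable {Γ : Type*} [Group Γ] [TopologicalSpace Γ] [IsTopologicalGroup Γ] {ι : Type*} {G : SimpleGraph ι} {a : Γ →* (G ≃g G)}

omit [IsTopologicalGroup Γ] in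
/-- **VERTEX STABILISERS ARE OPEN**: a subgroup `P` with `g ∈ P ↔ g·x = x` is the (open) stabiliser set of `x`. [cite: SchneiderStuhler1997, Ch. III §4] -/
theorem isOpen_of_forall_mem_iff_apply_eq (hstab : ∀ x : ι, IsOpen {g : Γ | a g x = x}) {P : Subgroup Γ} {x : ι} (hP : ∀ g, g ∈ P ↔ a g x = x) :
    IsOpen (P : Set Γ) := by
  have hset : (P : Set Γ) = {g : Γ | a g x = x} := Set.ext fun g => hP g
  rw [hset]
  exact hstab x

/-- **EDGE STABILISERS ARE OPEN**: a subgroup `P` with `g ∈ P ↔ g·e = e` contains the open two-point stabiliser `Stab(head e) ∩ Stab(tail e)` (an automorphism fixing both ends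
fixes the edge), a neighbourhood of `1`; a subgroup that is a neighbourhood of `1` is open. [cite: SchneiderStuhler1997, Ch. III §4] -/
theorem isOpen_of_forall_mem_iff_mapEdgeSet_eq (hstab : ∀ x : ι, IsOpen {g : Γ | a g x = x}) (σ : Orientation G) {P : Subgroup Γ} {e : G.edgeSet}
    (hP : ∀ g, g ∈ P ↔ (a g).mapEdgeSet e = e) : IsOpen (P : Set Γ) := by
  refine Subgroup.isOpen_of_mem_nhds P (g := 1) ?_
  refine Filter.mem_of_superset (((hstab (σ.head e)).inter (hstab (σ.tail e))).mem_nhds ⟨by simp, by simp⟩) fun g hg => ?_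
  rw [SetLike.mem_coe, hP]
  refine Subtype.ext ?_
  rw [coe_mapEdgeSet σ (a g) e, hg.1, hg.2, σ.mk_head_tail]

omit [IsTopologicalGroup Γ] in
/-- **THE LOCAL REPRESENTATION ON AN INVARIANT SUBSPACE OF A SMOOTH `ρ` IS SMOOTH**: `σ` a representation of `P ≤ Γ` on a submodule `W ≤ V` with `↑(σ p w) = ρ(p) w` (FILE A
`isSmooth_of_chart` with the chart `W ↪ V`). [cite: SchneiderStuhler1997, Ch. III §4] -/
theorem isSmooth_of_coe_apply_eq {k V : Type*} [CommRing k] [AddCommGroup V] [Module k V] {ρ : Representation k Γ V} (hρ : ρ.IsSmooth) {P : Subgroup Γ} {W : Submodule k V}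
    {σ : Representation k P W} (hσ : ∀ (p : P) (w : W), ((σ p w : W) : V) = ρ (p : Γ) w) : σ.IsSmooth :=
  isSmooth_of_chart (j := W.subtype) hρ W.injective_subtype fun p w => hσ p w

end Stabilizers

section Chains

variable {k Γ V : Type*} [Field k] [Group Γ] [TopologicalSpace Γ] [IsTopologicalGroup Γ] [AddCommGroup V] [Module k V] {ρ : Representation k Γ V}
variable {ι : Type*} [DecidableEq ι] {G : SimpleGraph ι} {a : Γ →* (G ≃g G)}
variable {τ : Representation k Γ (ι →₀ V)} (hτ : ∀ (g : Γ) (v : ι →₀ V), τ g v = Finsupp.mapRange (ρ g) (map_zero _) (Finsupp.equivMapDomain (a g).toEquiv v))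
variable {τ₁ : Representation k Γ (G.edgeSet →₀ V)}
  (hτ₁ : ∀ (g : Γ) (c : G.edgeSet →₀ V), τ₁ g c = Finsupp.mapRange (ρ g) (map_zero _) (Finsupp.equivMapDomain (a g).mapEdgeSet c))

/-! ## §2 Vertices: `C₀(X) ≅ ⊕_i c-Ind_{P₀ i}^Γ σ₀ i` -/

omit [TopologicalSpace Γ] [IsTopologicalGroup Γ] [DecidableEq ι] in
/-- `[x ↦ w] ∈ C₀(X)` for `w ∈ V^{U_x}`. [cite: SchneiderStuhler1997, Ch. II §3] -/
theorem single_fixedPoints_mem_zeroChains_univ (U : ι → Subgroup Γ) (x : ι) (w : ρ.fixedPoints (U x)) :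
    Finsupp.single x (w : V) ∈ ⨆ x ∈ (Set.univ : Set ι), (ρ.fixedPoints (U x)).map (Finsupp.lsingle x : V →ₗ[k] ι →₀ V) := by
  refine Submodule.mem_iSup_of_mem x (Submodule.mem_iSup_of_mem (Set.mem_univ x) ?_)
  exact Submodule.mem_map.2 ⟨w, w.2, rfl⟩

omit [DecidableEq ι] in
include hτ in
/-- **`C₀(X) ≅ ⊕_{i} c-Ind_{P₀ i}^Γ σ₀ i` AS `Γ`-REPRESENTATIONS** (the vertex chain space of the global Schneider–Stuhler complex is the direct sum, over representatives of the
`Γ`-orbits of vertices, of the compact inductions of the local representations `V^{U_{x_i}}` of the stabilisers), the equivalence sending a `P₀ i`-supported `F ∈ c-Ind σ₀ i` in the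
`i`-th summand to the `0`-chain `[xv i ↦ F(1)]`.  Hypotheses: open vertex stabilisers, `ρ` smooth, transported vertex groups (`hUa`), vertex orbit data `xv idx₀ tr₀`, stabilisers `P₀`
(`g ∈ P₀ i ↔ g·xv i = xv i`) and local representations `σ₀ i` on `V^{U_{xv i}}` agreeing with `ρ`. [cite: SchneiderStuhler1997, Ch. II §2–§3] [cite: MeyerSolleveld2010, §2]
[cite: Brown1982, III §5] -/
theorem exists_equiv_directSum_cIndRep_zeroChains (hstab : ∀ x : ι, IsOpen {g : Γ | a g x = x}) (hρ : ρ.IsSmooth) (U : ι → Subgroup Γ)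
    (hUa : ∀ (g : Γ) (x : ι), U (a g x) = (U x).map (MulAut.conj g).toMonoidHom)
    {ρ₀ : Representation k Γ ↥(⨆ x ∈ (Set.univ : Set ι), (ρ.fixedPoints (U x)).map (Finsupp.lsingle x : V →ₗ[k] ι →₀ V))} (hρ₀ : ∀ (g : Γ) v, ((ρ₀ g v : _) : ι →₀ V) = τ g v)
    {ι₀ : Type*} [DecidableEq ι₀] (xv : ι₀ → ι) (idx₀ : ι → ι₀) (tr₀ : ι → Γ) (hidx₀ : ∀ i, idx₀ (xv i) = i) (hidx₀a : ∀ (g : Γ) (x : ι), idx₀ (a g x) = idx₀ x)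
    (htr₀ : ∀ x, a (tr₀ x) (xv (idx₀ x)) = x) (P₀ : ι₀ → Subgroup Γ) (hP₀ : ∀ i g, g ∈ P₀ i ↔ a g (xv i) = xv i)
    (σ₀ : ∀ i, Representation k (P₀ i) ↥(ρ.fixedPoints (U (xv i)))) (hσ₀ : ∀ (i : ι₀) (p : P₀ i) (w : ρ.fixedPoints (U (xv i))), ((σ₀ i p w : _) : V) = ρ (p : Γ) w) :
    ∃ e : (Representation.directSum fun i => cIndRep (P₀ i) (σ₀ i)).Equiv ρ₀,
      ∀ (i : ι₀) (F : CInd (P₀ i) (σ₀ i)), (∀ y : Γ, y ∉ P₀ i → (cIndToSmoothInd (P₀ i) (σ₀ i) F).toFun y = 0) →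
        ((e (DirectSum.lof k ι₀ (fun i => CInd (P₀ i) (σ₀ i)) i F) : _) : ι →₀ V) = Finsupp.single (xv i) (((cIndToSmoothInd (P₀ i) (σ₀ i) F).toFun 1 : _) : V) := by
  classical
  -- the charts `w ↦ [xv i ↦ w]`
  let j : ∀ i : ι₀, ↥(ρ.fixedPoints (U (xv i))) →ₗ[k] ↥(⨆ x ∈ (Set.univ : Set ι), (ρ.fixedPoints (U x)).map (Finsupp.lsingle x : V →ₗ[k] ι →₀ V)) := fun i =>
    LinearMap.codRestrict _ ((Finsupp.lsingle (xv i) : V →ₗ[k] ι →₀ V) ∘ₗ (ρ.fixedPoints (U (xv i))).subtype) fun w => single_fixedPoints_mem_zeroChains_univ U (xv i) w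
  have hj : ∀ (i : ι₀) (w : ρ.fixedPoints (U (xv i))), ((j i w : _) : ι →₀ V) = Finsupp.single (xv i) (w : V) := fun i w => rfl
  have hjinj : ∀ i, Injective (j i) := fun i w w' hww => by
    have h1 := congrArg (fun c : ↥(⨆ x ∈ (Set.univ : Set ι), (ρ.fixedPoints (U x)).map (Finsupp.lsingle x : V →ₗ[k] ι →₀ V)) => ((c : ι →₀ V) (xv i))) hww
    simp only [hj, Finsupp.single_eq_same] at h1
    exact Subtype.ext h1
  have hjr : ∀ i, LinearMap.range (j i) = ((ρ.fixedPoints (U (xv i))).map (Finsupp.lsingle (xv i) : V →ₗ[k] ι →₀ V)).comap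
      (⨆ x ∈ (Set.univ : Set ι), (ρ.fixedPoints (U x)).map (Finsupp.lsingle x : V →ₗ[k] ι →₀ V)).subtype := by
    intro i
    ext c
    simp only [LinearMap.mem_range, Submodule.mem_comap, Submodule.subtype_apply, Submodule.mem_map, Finsupp.lsingle_apply]
    constructor
    · rintro ⟨w, rfl⟩
      exact ⟨w, w.2, (hj i w).symm⟩
    · rintro ⟨w, hw, hwc⟩
      exact ⟨⟨w, hw⟩, Subtype.ext (by rw [hj, hwc])⟩
  have hjσ : ∀ (i : ι₀) (p : P₀ i) (w : ρ.fixedPoints (U (xv i))), j i (σ₀ i p w) = ρ₀ (p : Γ) (j i w) := by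
    intro i p w
    refine Subtype.ext ?_
    rw [hj, hσ₀, hρ₀, hj, rep_zeroChains_single hτ, (hP₀ i _).1 p.2]
  obtain ⟨e, he, -⟩ := exists_equiv_directSum_cIndRep (ρ := ρ₀) (σ := σ₀) (j := j) (isInternal_zeroBlocks_univ U)
    (fun g g' x => by rw [map_mul]; rfl) (fun x => by rw [map_one]; rfl)
    (fun g x m hm => rep_mem_zeroBlock hτ U Set.univ hUa hρ₀ g x m hm) xv idx₀ tr₀ hidx₀ hidx₀a htr₀ hP₀
    (fun i => isOpen_of_forall_mem_iff_apply_eq hstab (hP₀ i)) hjinj hjr hjσ (fun i => isSmooth_of_coe_apply_eq hρ (hσ₀ i))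
  exact ⟨e, fun i F hF => by rw [he i F hF, hj]⟩

omit [DecidableEq ι] in
include hτ in
/-- **`dim Hom_Γ(C₀(X), π) = Σ_i dim Hom_{P₀ i}(σ₀ i, π|_{P₀ i})`** for finitely many vertex orbits and finite-dimensional local Hom-spaces (FILE A §4: Frobenius reciprocity summand
by summand) — the degree-`0` half of ★ 42's right-hand side at the Schneider–Stuhler datum. [cite: SchneiderStuhler1997, Ch. III §4] [cite: MeyerSolleveld2010, §2] -/
theorem finrank_intertwiningMap_zeroChains_eq_sum (hstab : ∀ x : ι, IsOpen {g : Γ | a g x = x}) (hρ : ρ.IsSmooth) (U : ι → Subgroup Γ)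
    (hUa : ∀ (g : Γ) (x : ι), U (a g x) = (U x).map (MulAut.conj g).toMonoidHom)
    {ρ₀ : Representation k Γ ↥(⨆ x ∈ (Set.univ : Set ι), (ρ.fixedPoints (U x)).map (Finsupp.lsingle x : V →ₗ[k] ι →₀ V))} (hρ₀ : ∀ (g : Γ) v, ((ρ₀ g v : _) : ι →₀ V) = τ g v)
    {ι₀ : Type*} [Fintype ι₀] [DecidableEq ι₀] (xv : ι₀ → ι) (idx₀ : ι → ι₀) (tr₀ : ι → Γ) (hidx₀ : ∀ i, idx₀ (xv i) = i) (hidx₀a : ∀ (g : Γ) (x : ι), idx₀ (a g x) = idx₀ x)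
    (htr₀ : ∀ x, a (tr₀ x) (xv (idx₀ x)) = x) (P₀ : ι₀ → Subgroup Γ) (hP₀ : ∀ i g, g ∈ P₀ i ↔ a g (xv i) = xv i)
    (σ₀ : ∀ i, Representation k (P₀ i) ↥(ρ.fixedPoints (U (xv i)))) (hσ₀ : ∀ (i : ι₀) (p : P₀ i) (w : ρ.fixedPoints (U (xv i))), ((σ₀ i p w : _) : V) = ρ (p : Γ) w)
    {N : Type*} [AddCommGroup N] [Module k N] (π : Representation k Γ N) [∀ i, FiniteDimensional k ((σ₀ i).IntertwiningMap (π.comp (P₀ i).subtype))] :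
    Module.finrank k (ρ₀.IntertwiningMap π) = ∑ i, Module.finrank k ((σ₀ i).IntertwiningMap (π.comp (P₀ i).subtype)) := by
  classical
  obtain ⟨e, -⟩ := exists_equiv_directSum_cIndRep_zeroChains hτ hstab hρ U hUa hρ₀ xv idx₀ tr₀ hidx₀ hidx₀a htr₀ P₀ hP₀ σ₀ hσ₀
  rw [← finrank_intertwiningMap_directSum_cIndRep_eq_sum P₀ σ₀ π (fun i => isOpen_of_forall_mem_iff_apply_eq hstab (hP₀ i))
    (fun i => isSmooth_of_coe_apply_eq hρ (hσ₀ i))]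
  exact (Literature.RepresentationTheory.Semisimple.Representation.IntertwiningMap.congrLeft e π).finrank_eq.symm

/-! ## §3 Edges: `C₁(X) ≅ ⊕_i c-Ind_{P₁ i}^Γ σ₁ i` -/

omit [TopologicalSpace Γ] [IsTopologicalGroup Γ] [DecidableEq ι] in
/-- `[e ↦ w] ∈ C₁(X)` for `w ∈ V^{U_e}`. [cite: SchneiderStuhler1997, Ch. II §3] -/
theorem single_fixedPoints_mem_oneChains_univ (σ : Orientation G) (U : ι → Subgroup Γ) (e : G.edgeSet) (w : ρ.fixedPoints (U (σ.head e) ⊔ U (σ.tail e))) :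
    Finsupp.single e (w : V) ∈ ⨆ e ∈ {e : G.edgeSet | σ.head e ∈ (Set.univ : Set ι) ∧ σ.tail e ∈ (Set.univ : Set ι)},
      (ρ.fixedPoints (U (σ.head e) ⊔ U (σ.tail e))).map (Finsupp.lsingle e : V →ₗ[k] G.edgeSet →₀ V) := by
  refine Submodule.mem_iSup_of_mem e (Submodule.mem_iSup_of_mem ⟨Set.mem_univ _, Set.mem_univ _⟩ ?_)
  exact Submodule.mem_map.2 ⟨w, w.2, rfl⟩

omit [DecidableEq ι] in
include hτ₁ in
/-- **`C₁(X) ≅ ⊕_{i} c-Ind_{P₁ i}^Γ σ₁ i` AS `Γ`-REPRESENTATIONS** (edge chain space; representatives `xe` of the `Γ`-orbits of edges, `g·e = (a g).mapEdgeSet e`, an invariant orientation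
`σ`, local representations `σ₁ i` of the edge stabilisers on `V^{U_e} = V^{U_{head e} ⊔ U_{tail e}}`). [cite: SchneiderStuhler1997, Ch. II §2–§3] [cite: MeyerSolleveld2010, §2] [cite: Brown1982, III §5] -/
theorem exists_equiv_directSum_cIndRep_oneChains (hstab : ∀ x : ι, IsOpen {g : Γ | a g x = x}) (hρ : ρ.IsSmooth) (σ : Orientation G) (U : ι → Subgroup Γ)
    (hUa : ∀ (g : Γ) (x : ι), U (a g x) = (U x).map (MulAut.conj g).toMonoidHom)
    (hσa : ∀ (g : Γ) (e : G.edgeSet), σ.head ((a g).mapEdgeSet e) = a g (σ.head e) ∧ σ.tail ((a g).mapEdgeSet e) = a g (σ.tail e))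
    {ρ₁ : Representation k Γ ↥(⨆ e ∈ {e : G.edgeSet | σ.head e ∈ (Set.univ : Set ι) ∧ σ.tail e ∈ (Set.univ : Set ι)},
      (ρ.fixedPoints (U (σ.head e) ⊔ U (σ.tail e))).map (Finsupp.lsingle e : V →ₗ[k] G.edgeSet →₀ V))}
    (hρ₁ : ∀ (g : Γ) c, ((ρ₁ g c : _) : G.edgeSet →₀ V) = τ₁ g c)
    {ι₁ : Type*} [DecidableEq ι₁] (xe : ι₁ → G.edgeSet) (idx₁ : G.edgeSet → ι₁) (tr₁ : G.edgeSet → Γ) (hidx₁ : ∀ i, idx₁ (xe i) = i)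
    (hidx₁a : ∀ (g : Γ) (e : G.edgeSet), idx₁ ((a g).mapEdgeSet e) = idx₁ e) (htr₁ : ∀ e : G.edgeSet, (a (tr₁ e)).mapEdgeSet (xe (idx₁ e)) = e)
    (P₁ : ι₁ → Subgroup Γ) (hP₁ : ∀ i g, g ∈ P₁ i ↔ (a g).mapEdgeSet (xe i) = xe i)
    (σ₁ : ∀ i, Representation k (P₁ i) ↥(ρ.fixedPoints (U (σ.head (xe i)) ⊔ U (σ.tail (xe i)))))
    (hσ₁ : ∀ (i : ι₁) (p : P₁ i) (w : ρ.fixedPoints (U (σ.head (xe i)) ⊔ U (σ.tail (xe i)))), ((σ₁ i p w : _) : V) = ρ (p : Γ) w) :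
    ∃ e : (Representation.directSum fun i => cIndRep (P₁ i) (σ₁ i)).Equiv ρ₁,
      ∀ (i : ι₁) (F : CInd (P₁ i) (σ₁ i)), (∀ y : Γ, y ∉ P₁ i → (cIndToSmoothInd (P₁ i) (σ₁ i) F).toFun y = 0) →
        ((e (DirectSum.lof k ι₁ (fun i => CInd (P₁ i) (σ₁ i)) i F) : _) : G.edgeSet →₀ V) = Finsupp.single (xe i) (((cIndToSmoothInd (P₁ i) (σ₁ i) F).toFun 1 : _) : V) := by
  classical
  let j : ∀ i : ι₁, ↥(ρ.fixedPoints (U (σ.head (xe i)) ⊔ U (σ.tail (xe i)))) →ₗ[k] ↥(⨆ e ∈ {e : G.edgeSet | σ.head e ∈ (Set.univ : Set ι) ∧ σ.tail e ∈ (Set.univ : Set ι)},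
      (ρ.fixedPoints (U (σ.head e) ⊔ U (σ.tail e))).map (Finsupp.lsingle e : V →ₗ[k] G.edgeSet →₀ V)) := fun i =>
    LinearMap.codRestrict _ ((Finsupp.lsingle (xe i) : V →ₗ[k] G.edgeSet →₀ V) ∘ₗ (ρ.fixedPoints (U (σ.head (xe i)) ⊔ U (σ.tail (xe i)))).subtype)
      fun w => single_fixedPoints_mem_oneChains_univ σ U (xe i) w
  have hj : ∀ (i : ι₁) (w : ρ.fixedPoints (U (σ.head (xe i)) ⊔ U (σ.tail (xe i)))), ((j i w : _) : G.edgeSet →₀ V) = Finsupp.single (xe i) (w : V) := fun i w => rfl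
  have hjinj : ∀ i, Injective (j i) := fun i w w' hww => by
    have h1 := congrArg (fun c : ↥(⨆ e ∈ {e : G.edgeSet | σ.head e ∈ (Set.univ : Set ι) ∧ σ.tail e ∈ (Set.univ : Set ι)},
      (ρ.fixedPoints (U (σ.head e) ⊔ U (σ.tail e))).map (Finsupp.lsingle e : V →ₗ[k] G.edgeSet →₀ V)) => ((c : G.edgeSet →₀ V) (xe i))) hww
    simp only [hj, Finsupp.single_eq_same] at h1
    exact Subtype.ext h1
  have hjr : ∀ i, LinearMap.range (j i) = ((ρ.fixedPoints (U (σ.head (xe i)) ⊔ U (σ.tail (xe i)))).map (Finsupp.lsingle (xe i) : V →ₗ[k] G.edgeSet →₀ V)).comap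
      (⨆ e ∈ {e : G.edgeSet | σ.head e ∈ (Set.univ : Set ι) ∧ σ.tail e ∈ (Set.univ : Set ι)},
        (ρ.fixedPoints (U (σ.head e) ⊔ U (σ.tail e))).map (Finsupp.lsingle e : V →ₗ[k] G.edgeSet →₀ V)).subtype := by
    intro i
    ext c
    simp only [LinearMap.mem_range, Submodule.mem_comap, Submodule.subtype_apply, Submodule.mem_map, Finsupp.lsingle_apply]
    constructor
    · rintro ⟨w, rfl⟩
      exact ⟨w, w.2, (hj i w).symm⟩
    · rintro ⟨w, hw, hwc⟩
      exact ⟨⟨w, hw⟩, Subtype.ext (by rw [hj, hwc])⟩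
  have hjσ : ∀ (i : ι₁) (p : P₁ i) (w : ρ.fixedPoints (U (σ.head (xe i)) ⊔ U (σ.tail (xe i)))), j i (σ₁ i p w) = ρ₁ (p : Γ) (j i w) := by
    intro i p w
    refine Subtype.ext ?_
    rw [hj, hσ₁, hρ₁, hj, rep_oneChains_single hτ₁, (hP₁ i _).1 p.2]
  obtain ⟨e, he, -⟩ := exists_equiv_directSum_cIndRep (ρ := ρ₁) (σ := σ₁) (j := j) (act := fun g e => (a g).mapEdgeSet e) (isInternal_oneBlocks_univ σ U)
    (fun g g' e => by rw [map_mul, mapEdgeSet_mul]) (fun e => by rw [map_one, mapEdgeSet_one])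
    (fun g e m hm => rep_mem_oneBlock hτ₁ σ U Set.univ hUa hσa hρ₁ g e m hm)
    xe idx₁ tr₁ hidx₁ hidx₁a htr₁ hP₁ (fun i => isOpen_of_forall_mem_iff_mapEdgeSet_eq hstab σ (hP₁ i)) hjinj hjr hjσ (fun i => isSmooth_of_coe_apply_eq hρ (hσ₁ i))
  exact ⟨e, fun i F hF => by rw [he i F hF, hj]⟩

omit [DecidableEq ι] in
include hτ₁ in
/-- **`dim Hom_Γ(C₁(X), π) = Σ_i dim Hom_{P₁ i}(σ₁ i, π|_{P₁ i})`** for finitely many edge orbits and finite-dimensional local Hom-spaces — the degree-`1` half of ★ 42's right-hand side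
at the Schneider–Stuhler datum. [cite: SchneiderStuhler1997, Ch. III §4] [cite: MeyerSolleveld2010, §2] -/
theorem finrank_intertwiningMap_oneChains_eq_sum (hstab : ∀ x : ι, IsOpen {g : Γ | a g x = x}) (hρ : ρ.IsSmooth) (σ : Orientation G) (U : ι → Subgroup Γ)
    (hUa : ∀ (g : Γ) (x : ι), U (a g x) = (U x).map (MulAut.conj g).toMonoidHom)
    (hσa : ∀ (g : Γ) (e : G.edgeSet), σ.head ((a g).mapEdgeSet e) = a g (σ.head e) ∧ σ.tail ((a g).mapEdgeSet e) = a g (σ.tail e))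
    {ρ₁ : Representation k Γ ↥(⨆ e ∈ {e : G.edgeSet | σ.head e ∈ (Set.univ : Set ι) ∧ σ.tail e ∈ (Set.univ : Set ι)},
      (ρ.fixedPoints (U (σ.head e) ⊔ U (σ.tail e))).map (Finsupp.lsingle e : V →ₗ[k] G.edgeSet →₀ V))}
    (hρ₁ : ∀ (g : Γ) c, ((ρ₁ g c : _) : G.edgeSet →₀ V) = τ₁ g c)
    {ι₁ : Type*} [Fintype ι₁] [DecidableEq ι₁] (xe : ι₁ → G.edgeSet) (idx₁ : G.edgeSet → ι₁) (tr₁ : G.edgeSet → Γ) (hidx₁ : ∀ i, idx₁ (xe i) = i)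
    (hidx₁a : ∀ (g : Γ) (e : G.edgeSet), idx₁ ((a g).mapEdgeSet e) = idx₁ e) (htr₁ : ∀ e : G.edgeSet, (a (tr₁ e)).mapEdgeSet (xe (idx₁ e)) = e)
    (P₁ : ι₁ → Subgroup Γ) (hP₁ : ∀ i g, g ∈ P₁ i ↔ (a g).mapEdgeSet (xe i) = xe i)
    (σ₁ : ∀ i, Representation k (P₁ i) ↥(ρ.fixedPoints (U (σ.head (xe i)) ⊔ U (σ.tail (xe i)))))
    (hσ₁ : ∀ (i : ι₁) (p : P₁ i) (w : ρ.fixedPoints (U (σ.head (xe i)) ⊔ U (σ.tail (xe i)))), ((σ₁ i p w : _) : V) = ρ (p : Γ) w)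
    {N : Type*} [AddCommGroup N] [Module k N] (π : Representation k Γ N) [∀ i, FiniteDimensional k ((σ₁ i).IntertwiningMap (π.comp (P₁ i).subtype))] :
    Module.finrank k (ρ₁.IntertwiningMap π) = ∑ i, Module.finrank k ((σ₁ i).IntertwiningMap (π.comp (P₁ i).subtype)) := by
  classical
  obtain ⟨e, -⟩ := exists_equiv_directSum_cIndRep_oneChains hτ₁ hstab hρ σ U hUa hσa hρ₁ xe idx₁ tr₁ hidx₁ hidx₁a htr₁ P₁ hP₁ σ₁ hσ₁
  rw [← finrank_intertwiningMap_directSum_cIndRep_eq_sum P₁ σ₁ π (fun i => isOpen_of_forall_mem_iff_mapEdgeSet_eq hstab σ (hP₁ i))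
    (fun i => isSmooth_of_coe_apply_eq hρ (hσ₁ i))]
  exact (Literature.RepresentationTheory.Semisimple.Representation.IntertwiningMap.congrLeft e π).finrank_eq.symm

end Chains

/-! ## §4 The ★45-shaped junction: `q`-chains over `univ.filter (d · = q)` on `ι₀ ⊕ ι₁`, and the end-to-end line -/

section Junction

variable {k Γ : Type*} [Field k] [Group Γ] [TopologicalSpace Γ] [IsTopologicalGroup Γ]
  {ι₀ ι₁ : Type*} [Fintype ι₀] [Fintype ι₁]
  {W : ι₀ ⊕ ι₁ → Type*} [∀ i, AddCommGroup (W i)] [∀ i, Module k (W i)] (P : ι₀ ⊕ ι₁ → Subgroup Γ) (τ : ∀ i, Representation k (P i) (W i))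
  {N : Type*} [AddCommGroup N] [Module k N] (π : Representation k Γ N)

/-- **★ 45's `q`-CHAIN COUNT ON `ι₀ ⊕ ι₁`, `q = 0`**: with `d := Sum.elim 0 1`, `dim Hom_Γ(⨁_{i ∈ univ.filter (d · = 0)} c-Ind_{P i} τ i, π) = Σ_{i ∈ ι₀} dim Hom_{P (inl i)}(τ (inl i), π|)`
(★ 45 §3 + the filter is the range of `inl`).  Combine with §2 `finrank_intertwiningMap_zeroChains_eq_sum` (family `P ∘ inl = P₀`, `τ ∘ inl = σ₀`) to read ★ 45's `C₀` as `Hom_Γ(C₀(X), π)`.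
[cite: SchneiderStuhler1997, Ch. III §4] -/
theorem finrank_intertwiningMap_directSum_cIndRep_filter_zero (hP : ∀ i, IsOpen (P i : Set Γ)) (hτ : ∀ i, (τ i).IsSmooth)
    [∀ i, FiniteDimensional k ((τ i).IntertwiningMap (π.comp (P i).subtype))] :
    Module.finrank k ((Representation.directSum fun i : ↥((Finset.univ : Finset (ι₀ ⊕ ι₁)).filter fun i => Sum.elim (fun _ => 0) (fun _ => 1) i = 0) =>
        cIndRep (P i) (τ i)).IntertwiningMap π) =
      ∑ i : ι₀, Module.finrank k ((τ (Sum.inl i)).IntertwiningMap (π.comp (P (Sum.inl i)).subtype)) := by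
  rw [finrank_intertwiningMap_directSum_cIndRep_eq_sum (fun i : ↥((Finset.univ : Finset (ι₀ ⊕ ι₁)).filter fun i => Sum.elim (fun _ => 0) (fun _ => 1) i = 0) => P i)
    (fun i => τ i) π (fun i => hP i) (fun i => hτ i),
    Finset.sum_coe_sort ((Finset.univ : Finset (ι₀ ⊕ ι₁)).filter fun i => Sum.elim (fun _ => 0) (fun _ => 1) i = 0)
      (fun i => Module.finrank k ((τ i).IntertwiningMap (π.comp (P i).subtype)))]
  have hfilter : ((Finset.univ : Finset (ι₀ ⊕ ι₁)).filter fun i => Sum.elim (fun _ => (0 : ℕ)) (fun _ => 1) i = 0) = (Finset.univ : Finset ι₀).map Function.Embedding.inl := by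
    ext i
    rcases i with i | i <;> simp
  rw [hfilter, Finset.sum_map]
  rfl

/-- **★ 45's `q`-CHAIN COUNT ON `ι₀ ⊕ ι₁`, `q = 1`**: `dim Hom_Γ(⨁_{i ∈ univ.filter (d · = 1)} c-Ind_{P i} τ i, π) = Σ_{i ∈ ι₁} dim Hom_{P (inr i)}(τ (inr i), π|)`; combine with §3
`finrank_intertwiningMap_oneChains_eq_sum`. [cite: SchneiderStuhler1997, Ch. III §4] -/
theorem finrank_intertwiningMap_directSum_cIndRep_filter_one (hP : ∀ i, IsOpen (P i : Set Γ)) (hτ : ∀ i, (τ i).IsSmooth)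
    [∀ i, FiniteDimensional k ((τ i).IntertwiningMap (π.comp (P i).subtype))] :
    Module.finrank k ((Representation.directSum fun i : ↥((Finset.univ : Finset (ι₀ ⊕ ι₁)).filter fun i => Sum.elim (fun _ => 0) (fun _ => 1) i = 1) =>
        cIndRep (P i) (τ i)).IntertwiningMap π) =
      ∑ i : ι₁, Module.finrank k ((τ (Sum.inr i)).IntertwiningMap (π.comp (P (Sum.inr i)).subtype)) := by
  rw [finrank_intertwiningMap_directSum_cIndRep_eq_sum (fun i : ↥((Finset.univ : Finset (ι₀ ⊕ ι₁)).filter fun i => Sum.elim (fun _ => 0) (fun _ => 1) i = 1) => P i)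
    (fun i => τ i) π (fun i => hP i) (fun i => hτ i),
    Finset.sum_coe_sort ((Finset.univ : Finset (ι₀ ⊕ ι₁)).filter fun i => Sum.elim (fun _ => 0) (fun _ => 1) i = 1)
      (fun i => Module.finrank k ((τ i).IntertwiningMap (π.comp (P i).subtype)))]
  have hfilter : ((Finset.univ : Finset (ι₀ ⊕ ι₁)).filter fun i => Sum.elim (fun _ => (0 : ℕ)) (fun _ => 1) i = 1) = (Finset.univ : Finset ι₁).map Function.Embedding.inr := by
    ext i
    rcases i with i | i <;> simp
  rw [hfilter, Finset.sum_map]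
  rfl

omit [TopologicalSpace Γ] [IsTopologicalGroup Γ] in
/-- **THE END-TO-END LINE (ℤ-valued)**: for the family on `ι₀ ⊕ ι₁` with degrees `d = Sum.elim 0 1` and ANY two representations `ρ₀`, `ρ₁` whose Hom-counts are the vertex ∕ edge sums
(§2, §3 supply exactly these for `C₀(X)`, `C₁(X)`):  `Σ_i (−1)^{d i} dim Hom_{P i}(τ i, π|) = dim Hom_Γ(ρ₀, π) − dim Hom_Γ(ρ₁, π)`.  With ★ 42 (`tr π(f_EP) = ` the left side) and ★ (J)
`finrank_intertwiningMap_presentation` (the right side `= dim Hom_Γ(V, π)` over ★ 5a `shortExact_univ`, given `hsplit`) this is the K2′∕K4′ count. [cite: SchneiderStuhler1997, Ch. III §4] -/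
theorem alternatingSum_finrank_intertwiningMap_eq_sub {M₀ M₁ : Type*} [AddCommGroup M₀] [Module k M₀] [AddCommGroup M₁] [Module k M₁]
    {ρ₀ : Representation k Γ M₀} {ρ₁ : Representation k Γ M₁}
    (h₀ : Module.finrank k (ρ₀.IntertwiningMap π) = ∑ i : ι₀, Module.finrank k ((τ (Sum.inl i)).IntertwiningMap (π.comp (P (Sum.inl i)).subtype)))
    (h₁ : Module.finrank k (ρ₁.IntertwiningMap π) = ∑ i : ι₁, Module.finrank k ((τ (Sum.inr i)).IntertwiningMap (π.comp (P (Sum.inr i)).subtype))) :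
    ∑ i : ι₀ ⊕ ι₁, (-1 : ℤ) ^ (Sum.elim (fun _ => 0) (fun _ => 1) i : ℕ) * (Module.finrank k ((τ i).IntertwiningMap (π.comp (P i).subtype)) : ℤ) =
      (Module.finrank k (ρ₀.IntertwiningMap π) : ℤ) - (Module.finrank k (ρ₁.IntertwiningMap π) : ℤ) := by
  rw [Fintype.sum_sum_type, h₀, h₁, Nat.cast_sum, Nat.cast_sum, sub_eq_add_neg, ← Finset.sum_neg_distrib]
  congr 1
  · exact Finset.sum_congr rfl fun i _ => by simp
  · exact Finset.sum_congr rfl fun i _ => by simp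

end Junction

/-! ## §5 (ED. 2, append-only) Finiteness of `Hom_Γ(C₀(X), π)` and `Hom_Γ(C₁(X), π)` — the §2∕§3 equivalences read for `Module.Finite` (the PAIR trace identity of the
EXT-ROAD spends them at a target `π ≠ ρ`, where no presentation count is available) -/

section ChainsFinite

variable {k Γ V : Type*} [Field k] [Group Γ] [TopologicalSpace Γ] [IsTopologicalGroup Γ] [AddCommGroup V] [Module k V] {ρ : Representation k Γ V}
variable {ι : Type*} [DecidableEq ι] {G : SimpleGraph ι} {a : Γ →* (G ≃g G)}
variable {τ : Representation k Γ (ι →₀ V)} (hτ : ∀ (g : Γ) (v : ι →₀ V), τ g v = Finsupp.mapRange (ρ g) (map_zero _) (Finsupp.equivMapDomain (a g).toEquiv v))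
variable {τ₁ : Representation k Γ (G.edgeSet →₀ V)}
  (hτ₁ : ∀ (g : Γ) (c : G.edgeSet →₀ V), τ₁ g c = Finsupp.mapRange (ρ g) (map_zero _) (Finsupp.equivMapDomain (a g).mapEdgeSet c))

omit [DecidableEq ι] in
include hτ in
/-- **`Hom_Γ(C₀(X), π)` IS FINITE-DIMENSIONAL** when the vertex orbits are finite in number and every local space `Hom_{P₀ i}(σ₀ i, π|)` is (§2's equivalence + ★ 45
`finite_intertwiningMap_directSum_cIndRep`); hypotheses = §2 `finrank_intertwiningMap_zeroChains_eq_sum`'s. [cite: SchneiderStuhler1997, Ch. III §4] [cite: MeyerSolleveld2010, §2] -/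
theorem finiteDimensional_intertwiningMap_zeroChains (hstab : ∀ x : ι, IsOpen {g : Γ | a g x = x}) (hρ : ρ.IsSmooth) (U : ι → Subgroup Γ)
    (hUa : ∀ (g : Γ) (x : ι), U (a g x) = (U x).map (MulAut.conj g).toMonoidHom)
    {ρ₀ : Representation k Γ ↥(⨆ x ∈ (Set.univ : Set ι), (ρ.fixedPoints (U x)).map (Finsupp.lsingle x : V →ₗ[k] ι →₀ V))} (hρ₀ : ∀ (g : Γ) v, ((ρ₀ g v : _) : ι →₀ V) = τ g v)
    {ι₀ : Type*} [Finite ι₀] [DecidableEq ι₀] (xv : ι₀ → ι) (idx₀ : ι → ι₀) (tr₀ : ι → Γ) (hidx₀ : ∀ i, idx₀ (xv i) = i) (hidx₀a : ∀ (g : Γ) (x : ι), idx₀ (a g x) = idx₀ x)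
    (htr₀ : ∀ x, a (tr₀ x) (xv (idx₀ x)) = x) (P₀ : ι₀ → Subgroup Γ) (hP₀ : ∀ i g, g ∈ P₀ i ↔ a g (xv i) = xv i)
    (σ₀ : ∀ i, Representation k (P₀ i) ↥(ρ.fixedPoints (U (xv i)))) (hσ₀ : ∀ (i : ι₀) (p : P₀ i) (w : ρ.fixedPoints (U (xv i))), ((σ₀ i p w : _) : V) = ρ (p : Γ) w)
    {N : Type*} [AddCommGroup N] [Module k N] (π : Representation k Γ N) [∀ i, FiniteDimensional k ((σ₀ i).IntertwiningMap (π.comp (P₀ i).subtype))] :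
    FiniteDimensional k (ρ₀.IntertwiningMap π) := by
  classical
  obtain ⟨e, -⟩ := exists_equiv_directSum_cIndRep_zeroChains hτ hstab hρ U hUa hρ₀ xv idx₀ tr₀ hidx₀ hidx₀a htr₀ P₀ hP₀ σ₀ hσ₀
  haveI := finite_intertwiningMap_directSum_cIndRep P₀ σ₀ π (fun i => isOpen_of_forall_mem_iff_apply_eq hstab (hP₀ i)) (fun i => isSmooth_of_coe_apply_eq hρ (hσ₀ i))
  exact Module.Finite.equiv (Literature.RepresentationTheory.Semisimple.Representation.IntertwiningMap.congrLeft e π)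

omit [DecidableEq ι] in
include hτ₁ in
/-- **`Hom_Γ(C₁(X), π)` IS FINITE-DIMENSIONAL** when the edge orbits are finite in number and every local space `Hom_{P₁ j}(σ₁ j, π|)` is (§3's equivalence + ★ 45);
hypotheses = §3 `finrank_intertwiningMap_oneChains_eq_sum`'s. [cite: SchneiderStuhler1997, Ch. III §4] [cite: MeyerSolleveld2010, §2] -/
theorem finiteDimensional_intertwiningMap_oneChains (hstab : ∀ x : ι, IsOpen {g : Γ | a g x = x}) (hρ : ρ.IsSmooth) (σ : Orientation G) (U : ι → Subgroup Γ)
    (hUa : ∀ (g : Γ) (x : ι), U (a g x) = (U x).map (MulAut.conj g).toMonoidHom)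
    (hσa : ∀ (g : Γ) (e : G.edgeSet), σ.head ((a g).mapEdgeSet e) = a g (σ.head e) ∧ σ.tail ((a g).mapEdgeSet e) = a g (σ.tail e))
    {ρ₁ : Representation k Γ ↥(⨆ e ∈ {e : G.edgeSet | σ.head e ∈ (Set.univ : Set ι) ∧ σ.tail e ∈ (Set.univ : Set ι)},
      (ρ.fixedPoints (U (σ.head e) ⊔ U (σ.tail e))).map (Finsupp.lsingle e : V →ₗ[k] G.edgeSet →₀ V))}
    (hρ₁ : ∀ (g : Γ) c, ((ρ₁ g c : _) : G.edgeSet →₀ V) = τ₁ g c)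
    {ι₁ : Type*} [Finite ι₁] [DecidableEq ι₁] (xe : ι₁ → G.edgeSet) (idx₁ : G.edgeSet → ι₁) (tr₁ : G.edgeSet → Γ) (hidx₁ : ∀ i, idx₁ (xe i) = i)
    (hidx₁a : ∀ (g : Γ) (e : G.edgeSet), idx₁ ((a g).mapEdgeSet e) = idx₁ e) (htr₁ : ∀ e : G.edgeSet, (a (tr₁ e)).mapEdgeSet (xe (idx₁ e)) = e)
    (P₁ : ι₁ → Subgroup Γ) (hP₁ : ∀ i g, g ∈ P₁ i ↔ (a g).mapEdgeSet (xe i) = xe i)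
    (σ₁ : ∀ i, Representation k (P₁ i) ↥(ρ.fixedPoints (U (σ.head (xe i)) ⊔ U (σ.tail (xe i)))))
    (hσ₁ : ∀ (i : ι₁) (p : P₁ i) (w : ρ.fixedPoints (U (σ.head (xe i)) ⊔ U (σ.tail (xe i)))), ((σ₁ i p w : _) : V) = ρ (p : Γ) w)
    {N : Type*} [AddCommGroup N] [Module k N] (π : Representation k Γ N) [∀ i, FiniteDimensional k ((σ₁ i).IntertwiningMap (π.comp (P₁ i).subtype))] :
    FiniteDimensional k (ρ₁.IntertwiningMap π) := by
  classical
  obtain ⟨e, -⟩ := exists_equiv_directSum_cIndRep_oneChains hτ₁ hstab hρ σ U hUa hσa hρ₁ xe idx₁ tr₁ hidx₁ hidx₁a htr₁ P₁ hP₁ σ₁ hσ₁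
  haveI := finite_intertwiningMap_directSum_cIndRep P₁ σ₁ π (fun i => isOpen_of_forall_mem_iff_mapEdgeSet_eq hstab σ (hP₁ i)) (fun i => isSmooth_of_coe_apply_eq hρ (hσ₁ i))
  exact Module.Finite.equiv (Literature.RepresentationTheory.Semisimple.Representation.IntertwiningMap.congrLeft e π)

end ChainsFinite

end Representation
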